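import Summits.MatrixMultiplication.MatrixMultiplication.Theses.OctonionicLaser

/-!
# Route OctonionicLaser — support item `OctRecordPayoff` (stmt-MatrixMultiplication-7939)

Pure real-number numerics: from `θ · 2^ω ≤ R̃(t₈)` with `θ = 3 / 2^(2/3)` (OctLaserBound, inlined as
a hypothesis) and `R̃(t₈) ≤ 39/4` (OctRecordThreshold, inlined) we get `2^(ω + 4/3) ≤ 13`; if
`ω ≥ 2.3672` then `ω + 4/3 ≥ 729/197` and `2^(729/197) > 13` because `2^729 > 13^197`, a
contradiction. Hence `ω(ℂ) < 2.3672` (indeed `ω ≤ log₂ 13 − 4/3 = 2.36711`).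
-/

set_option linter.dupNamespace false

namespace Summit.MatrixMultiplication.MatrixMultiplication.Theorems

open Summit.MatrixMultiplication.MatrixMultiplication.Theses.OctonionicLaser

/-- Numeric core of the payoff: if `3 / 2^(2/3) · 2^w ≤ 39/4` then `w < 2.3672`
(since `2^(w + 4/3) ≤ 13 < 2^(729/197)` and `729/197 ≤ 2.3672 + 4/3`). -/
theorem octRecordPayoff_numeric {w : ℝ}
    (h : (3 / (2:ℝ) ^ ((2:ℝ) / 3)) * (2:ℝ) ^ w ≤ 39 / 4) : w < 2.3672 := by
  have h23 : (2:ℝ) ^ ((2:ℝ) / 3) ≠ 0 := by positivity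
  -- `2^(2/3) · 2^(4/3) = 4`
  have e1 : (2:ℝ) ^ ((2:ℝ) / 3) * (2:ℝ) ^ ((4:ℝ) / 3) = 4 := by
    rw [← Real.rpow_add (by norm_num : (0:ℝ) < 2)]
    rw [show (2:ℝ) / 3 + 4 / 3 = 2 by norm_num, Real.rpow_two]
    norm_num
  -- `2^(w + 4/3) ≤ 13`
  have h13 : (2:ℝ) ^ (w + 4 / 3) ≤ 13 := by
    rw [Real.rpow_add (by norm_num : (0:ℝ) < 2)]
    have : (2:ℝ) ^ w * (2:ℝ) ^ ((4:ℝ) / 3)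
        = (3 / (2:ℝ) ^ ((2:ℝ) / 3) * (2:ℝ) ^ w) * ((2:ℝ) ^ ((2:ℝ) / 3) * (2:ℝ) ^ ((4:ℝ) / 3)) / 3 := by
      field_simp
    rw [this, e1]
    linarith
  -- `13 < 2^(729/197)` since `13^197 < 2^729`
  have h13lt : (13:ℝ) < (2:ℝ) ^ ((729:ℝ) / 197) := by
    have hpow : ((2:ℝ) ^ ((729:ℝ) / 197)) ^ (197:ℕ) = (2:ℝ) ^ (729:ℕ) := by
      rw [← Real.rpow_natCast, ← Real.rpow_mul (by norm_num : (0:ℝ) ≤ 2)]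
      rw [show (729:ℝ) / 197 * ((197:ℕ) : ℝ) = ((729:ℕ) : ℝ) by norm_num, Real.rpow_natCast]
    refine lt_of_pow_lt_pow_left₀ 197 (by positivity) ?_
    -- split `2^729 = (2^243)^3` so that numeral evaluation stays below `exponentiation.threshold`
    rw [hpow, show (729:ℕ) = 243 * 3 from rfl, pow_mul]
    norm_num
  by_contra hw
  rw [not_lt] at hw
  have hw' : (729:ℝ) / 197 ≤ w + 4 / 3 := by
    have : (2.3672:ℝ) = 2959 / 1250 := by norm_num
    rw [this] at hw
    linarith
  have hlow : (2:ℝ) ^ ((729:ℝ) / 197) ≤ (2:ℝ) ^ (w + 4 / 3) :=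
    Real.rpow_le_rpow_of_exponent_le (by norm_num : (1:ℝ) ≤ 2) hw'
  linarith

/-- Route OctonionicLaser, support item `OctRecordPayoff` (stmt-MatrixMultiplication-7939):
the octonionic laser bound `(3/2^(2/3)) · 2^ω ≤ R̃(t₈)` together with the record threshold
`R̃(t₈) ≤ 39/4` gives `ω(ℂ) < 2.3672` (below the 2.371339 record of Alman–Duan–Vassilevska
Williams–Xu–Xu–Zhou 2025); both hypotheses are inlined in the item, so this is the pure numerics
`2^ω ≤ (13/4) · 2^(2/3) ⇒ ω ≤ log₂ 13 − 4/3 = 2.36711 < 2.3672`. -/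
theorem octRecordPayoff_proof : OctRecordPayoff := by
  unfold OctRecordPayoff
  intro h₁ h₂
  exact octRecordPayoff_numeric (h₁.trans h₂)

end Summit.MatrixMultiplication.MatrixMultiplication.Theorems
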